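import Summits.Ventures.CertifiedManyBodySolver.Observables.StripeOrderKernelCeiling
import Summits.Ventures.CertifiedManyBodySolver.Rows.DopedTLSpinStar
import Summits.Ventures.CertifiedManyBodySolver.Transport.D4VecAction
import Literature.MathematicalPhysics.QuantumLattice.InfVolFermionStateCorrelationPositiveDefinite
import HarnessLib
import Summits.Ventures.CertifiedManyBodySolver.Certificates.HubbardSquare_n7o8_corr_lroGc_rows258_262
import Summits.Ventures.CertifiedManyBodySolver.Certificates.HubbardSquare_n7o8_corr_lroGs_rows259_263
import Summits.Ventures.CertifiedManyBodySolver.Rows.HalfFilledTLKinematic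

/-!
# Ventures/CertifiedManyBodySolver — Certificates/HubbardSquare_n7o8_stripeStar_dictionary.lean

HONEST FRAMING: first certified bounds; not a superconductivity verdict; every number certified or labelled float.

**G2 Stage 2 (S2b, charge side) for the stripe-order kernel ceilings** of CERTIFIED.md rows #262/#258 (charge) and
#263/#259 (spin): the CHARGE DICTIONARY lemmas that turn m3-4's measure-level theorems
`Observables/StripeOrderKernelCeiling.lean` (`chargeStar_braggWeight_le_r262/_r258`: theorems about an arbitrary finite
measure `μ` representing an arbitrary lattice function `C` with real-number side conditions) into statements about
thermodynamic-limit states.  Spec: pub-mbboot-lit g33 (INBOX 2026-08-21T18:59:51Z) + m3-4 g8 typing notes; S2a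
(`IsTranslationInvariant.isPositiveDefinite_corr`, Herglotz) is the LANDED
`Literature/MathematicalPhysics/QuantumLattice/InfVolFermionStateCorrelationPositiveDefinite.lean`; the linear `D₄` action
API (`d4Vec_add`, `d4_sum_*`, `unitVec_*_eq`, `d4Emb_pt`) is the LANDED `Transport/D4VecAction.lean` (lit-1 g10, p301716).
The spin dictionary and the six by-name instances are `Certificates/HubbardSquare_n7o8_stripeStar_instances.lean`.

## The objects

* `nnCorr ω v = Re ω_{{0,v}}(n_0 n_v)`, `docc ω = Re ω(n_{0↑}n_{0↓})`, `densnn ω = ¼ Σ_{v∈{±e₁,±e₂}} nnCorr ω v`.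
* `Dc = n_0 − 7/8 ∈ 𝔄_{{0}}` and the **D₄-orbit-mean connected density correlation**
  `chargeOrbitCorr ω r = 8⁻¹ Σ_{γ∈D₄} ω(Dc · τ_{γr} Dc)`, `IsPositiveDefinite` for translation-invariant `ω`
  (`isPositiveDefinite_chargeOrbitCorr`: S2a + `Transport.isPositiveDefinite_comp_d4Vec` + `sum` + `real_smul`).

## The dictionary (S2b, charge)

* `Re ω(Dc · τ_v Dc) = nnCorr ω v − 49/64` for density `7/8` (`re_corr_Dc`); `nnCorr ω 0 = ρ + 2·docc`
  (`n_0² = n_0 + 2 n_{0↑}n_{0↓}`, `NAt_mul_self`); the D₄ orbit of `e₁` meets each of `±e₁, ±e₂` twice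
  (`Transport.d4_sum_e1`), whence `Re C(0) = 7/64 + 2 docc`, `Re C(±eᵢ) = densnn − 49/64`; and the certified
  functional: `Re ω(Γ(γ) G_c) = (17/18) docc + (1/6)(nnCorr(γe₁) + nnCorr(γe₂))` (`re_expect_d4_chargeGc`, from the
  normal-ordered words of `chargeGc` by the CAR, `chargeGc_eq`), so the row's orbit mean is `(17/18) docc + (1/3) densnn`
  (`charge_hrow_of`).  The normal-ordering lemmas (`word_eq_numberOp*`) and `spinGsB_eq` for the spin side live here too.

Zero compute; no new numerics; no sorry.
-/

noncomputable section

namespace Summit.Ventures.CertifiedManyBodySolver.Certificates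

open Literature.MathematicalPhysics.QuantumLattice
open Literature.MathematicalPhysics.QuantumLattice.ThermodynamicLimit
open Literature.Probability.LatticeModels
open Filter Topology HubbardWave0 Literature.MathematicalPhysics.QuantumManyBody.StateRelaxation
open Summit.HubbardSuperconductivity.ManyBodyBootstrap.Bounds
open Summit.Ventures.CertifiedManyBodySolver.SpinStarTL
open Literature.MathematicalPhysics.QuantumLattice.FermionSpinMoment
open scoped Matrix BigOperators

open Summit.Ventures.CertifiedManyBodySolver.Transport

section Algebra

variable {ι : Type*} [LinearOrder ι] [Fintype ι]

/-- `c†_a c†_e c_e c_a = n_a n_e` for distinct orbitals. -/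
theorem word_eq_numberOp {Λ : Type*} [LinearOrder Λ] [Fintype Λ] {x y : Λ} {σ σ' : Fin 2}
    (h : orb x σ ≠ orb y σ') :
    (annihilation (orb x σ))ᴴ * (annihilation (orb y σ'))ᴴ * annihilation (orb y σ') * annihilation (orb x σ) =
      numberOp x σ * numberOp y σ' := by
  rw [annihilation_conjTranspose, annihilation_conjTranspose, numberOp, numberOp,
    creation_annihilation_mul_creation_annihilation_of_ne h]

/-- `c†_{xσ} c†_{yσ'} c_{yσ'} c_{xσ} = n_{xσ} n_{yσ'}` for distinct sites `x ≠ y`. -/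
theorem word_eq_numberOp_of_ne {Λ : Type*} [LinearOrder Λ] [Fintype Λ] {x y : Λ} (hxy : x ≠ y) (σ σ' : Fin 2) :
    (annihilation (orb x σ))ᴴ * (annihilation (orb y σ'))ᴴ * annihilation (orb y σ') * annihilation (orb x σ) =
      numberOp x σ * numberOp y σ' :=
  word_eq_numberOp fun h => hxy (orb_eq_orb_iff.1 h).1

/-- `c†_{x↑} c†_{x↓} c_{x↓} c_{x↑} = n_{x↑} n_{x↓}` (the double-occupancy word). -/
theorem word_eq_numberOp_self {Λ : Type*} [LinearOrder Λ] [Fintype Λ] (x : Λ) :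
    (annihilation (orb x 0))ᴴ * (annihilation (orb x 1))ᴴ * annihilation (orb x 1) * annihilation (orb x 0) =
      numberOp x 0 * numberOp x 1 :=
  word_eq_numberOp fun h => absurd (orb_eq_orb_iff.1 h).2 (by decide)

/-- Distinct sites give distinct `PolySite` points. -/
theorem pt_ne_pt_of_ne {d : ℕ} {Λ : Finset (Site d)} {x y : Site d} (hxy : x ≠ y) (hx : x ∈ Λ) (hy : y ∈ Λ) :
    PolySite.pt x hx ≠ PolySite.pt y hy := fun h =>
  hxy (by simpa using congrArg (fun z : PolySite Λ => ofLex z.1) h)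

/-- `0 ≠ e₂` in `ℤ²`. -/
theorem zero_ne_e2 : (0 : Site 2) ≠ unitVec 1 := fun h => by simpa [unitVec] using congrFun h 1

/-- The total site number operator `n_x = n_{x↑} + n_{x↓} ∈ 𝔄_Λ`. -/
abbrev NAt {d : ℕ} {Λ : Finset (Site d)} (x : Site d) (hx : x ∈ Λ) : FermionOp Λ := nAt x hx 0 + nAt x hx 1

/-- The row's charge functional `chargeGc` written in number operators: `(17/18) n_{0↑}n_{0↓} + (1/6)(n_0 n_{e₁} + n_0 n_{e₂})` (by the CAR, `chargeGc_eq`). -/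
theorem chargeGc_eq : chargeGc =
    ((17/18 : ℚ) : ℂ) • (nAt 0 zero_mem_nnSupport 0 * nAt 0 zero_mem_nnSupport 1) +
    ((1/6 : ℚ) : ℂ) • (NAt 0 zero_mem_nnSupport * NAt (unitVec 0) e1_mem_nnSupport +
      NAt 0 zero_mem_nnSupport * NAt (unitVec 1) e2_mem_nnSupport) := by
  unfold chargeGc
  simp only [cNN, cAt, NAt, nAt, word_eq_numberOp_self,
    word_eq_numberOp_of_ne (pt_ne_pt_of_ne M2.zero_ne_unitVec_zero zero_mem_nnSupport e1_mem_nnSupport),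
    word_eq_numberOp_of_ne (pt_ne_pt_of_ne zero_ne_e2 zero_mem_nnSupport e2_mem_nnSupport)]
  push_cast
  simp only [add_mul, mul_add]
  module

/-- The row's spin functional `spinGsB` written in `n_{0↑}n_{0↓}` and the spin dots `𝐒_0·𝐒_v`: `−(3/2) n_{0↑}n_{0↓} − (𝐒_0·𝐒_{e₁} + 𝐒_0·𝐒_{e₂}) + ½(𝐒_0·𝐒_{e₁+e₂} + 𝐒_0·𝐒_{e₂−e₁})`. -/
theorem spinGsB_eq : spinGsB =
    ((-3/2 : ℚ) : ℂ) • (nAt 0 zero_mem_gsSupportB 0 * nAt 0 zero_mem_gsSupportB 1) +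
    (-1 : ℂ) • (spinDotAt 0 zero_mem_gsSupportB (unitVec 0) e1_mem_gsSupportB +
      spinDotAt 0 zero_mem_gsSupportB (unitVec 1) e2_mem_gsSupportB) +
    (1/2 : ℂ) • (spinDotAt 0 zero_mem_gsSupportB (unitVec 0 + unitVec 1) e1pe2_mem_gsSupportB +
      spinDotAt 0 zero_mem_gsSupportB (unitVec 1 - unitVec 0) e2me1_mem_gsSupportB) := by
  unfold spinGsB
  rw [spinDotAt_eq_normalOrder M2.zero_ne_unitVec_zero, spinDotAt_eq_normalOrder zero_ne_e2,
    spinDotAt_eq_normalOrder e1pe2_ne_zero.symm, spinDotAt_eq_normalOrder e2me1_ne_zero.symm]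
  simp only [cGSB, cAt, nAt, word_eq_numberOp_self]
  push_cast
  module

end Algebra


section ChargeDictionary

variable {ω : InfVolFermionState 2}

/-- `pt x = pt y` for equal sites (transport of the membership proof). -/
theorem pt_congr' {d : ℕ} {Λ : Finset (Site d)} {x y : Site d} (h : x = y) (hx : x ∈ Λ) (hy : y ∈ Λ) :
    (PolySite.pt x hx : PolySite Λ) = PolySite.pt y hy :=
  Subtype.ext (congrArg toLex h)

/-- `shiftSet x {0} ⊆ {x}`. -/
theorem shiftSet_singleton_zero_subset' (x : Site 2) : shiftSet x ({0} : Finset (Site 2)) ⊆ {x} := by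
  intro z hz
  rw [mem_shiftSet, Finset.mem_singleton, sub_eq_zero] at hz
  rw [Finset.mem_singleton, hz]

/-- `shiftSet x {0, y − x} ⊆ {x, y}`. -/
theorem shiftSet_pair_subset' (x y : Site 2) :
    shiftSet x ({0, y - x} : Finset (Site 2)) ⊆ {x, y} := by
  intro z hz
  rw [mem_shiftSet, Finset.mem_insert, Finset.mem_singleton] at hz
  rw [Finset.mem_insert, Finset.mem_singleton]
  rcases hz with h | h
  · exact Or.inl (sub_eq_zero.1 h)
  · exact Or.inr (sub_left_injective h)

/-- The density–density two-point function `Re ω_{{0,v}}(n_0 n_v)`. -/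
def nnCorr (ω : InfVolFermionState 2) (v : Site 2) : ℝ :=
  (ω.expect {0, v} (NAt 0 (Finset.mem_insert_self 0 {v}) *
    NAt v (Finset.mem_insert_of_mem (Finset.mem_singleton_self v)))).re

/-- The double occupancy `Re ω(n_{0↑} n_{0↓})`. -/
def docc (ω : InfVolFermionState 2) : ℝ := (ω.expect {0} (doccAt0 2)).re

/-- `densnn = ¼ Σ_{v ∈ {±e₁, ±e₂}} Re ω(n_0 n_v)`. -/
def densnn (ω : InfVolFermionState 2) : ℝ :=
  (1/4) * (nnCorr ω ![1, 0] + nnCorr ω ![-1, 0] + nnCorr ω ![0, 1] + nnCorr ω ![0, -1])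

/-- `ω_Λ(n_x n_y)` only depends on the two-site window `{x, y}` (compatibility). -/
theorem expect_NAt_mul_NAt_eq_pair {Λ : Finset (Site 2)} (x y : Site 2) (hx : x ∈ Λ) (hy : y ∈ Λ) :
    ω.expect Λ (NAt x hx * NAt y hy) =
      ω.expect {x, y} (NAt x (Finset.mem_insert_self x {y}) *
        NAt y (Finset.mem_insert_of_mem (Finset.mem_singleton_self y))) := by
  have hsub : ({x, y} : Finset (Site 2)) ⊆ Λ :=
    Finset.insert_subset hx (Finset.singleton_subset_iff.2 hy)
  rw [← ω.compatible hsub]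
  simp only [NAt, nAt, map_mul, map_add, fermionEmbed_numberOp, PolySite.incl_pt]

/-- For translation-invariant `ω`, `Re ω_Λ(n_x n_y) = nnCorr ω (y − x)`. -/
theorem re_expect_NAt_mul_NAt_eq_corr (hω : ω.IsTranslationInvariant) {Λ : Finset (Site 2)}
    (x y : Site 2) (hx : x ∈ Λ) (hy : y ∈ Λ) :
    (ω.expect Λ (NAt x hx * NAt y hy)).re = nnCorr ω (y - x) := by
  rw [expect_NAt_mul_NAt_eq_pair, nnCorr]
  congr 1
  conv_rhs => rw [← hω x, InfVolFermionState.shift_expect]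
  refine ω.expect_fermionEmbed_incl_eq (subset_refl _) (shiftSet_pair_subset' x y) _ _ ?_
  simp only [NAt, nAt, map_mul, map_add, fermionEmbed_numberOp, PolySite.incl_pt, PolySite.shiftEmb_pt]
  rw [pt_congr' (zero_add x) _ (Finset.mem_insert_self x {y}),
    pt_congr' (sub_add_cancel y x) _ (Finset.mem_insert_of_mem (Finset.mem_singleton_self y))]

/-- For translation-invariant `ω`, `Re ω_Λ(n_{x↑} n_{x↓}) = docc ω`. -/
theorem re_expect_nAt_mul_nAt_eq_docc (hω : ω.IsTranslationInvariant) {Λ : Finset (Site 2)} (x : Site 2)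
    (hx : x ∈ Λ) : (ω.expect Λ (nAt x hx 0 * nAt x hx 1)).re = docc ω := by
  have hsub : ({x} : Finset (Site 2)) ⊆ Λ := Finset.singleton_subset_iff.2 hx
  have h := ω.compatible hsub (nAt x (Finset.mem_singleton_self x) 0 * nAt x (Finset.mem_singleton_self x) 1)
  simp only [nAt, map_mul, fermionEmbed_numberOp, PolySite.incl_pt] at h
  rw [h, docc, expect_nAt_mul_nAt_eq hω x]

/-- `n_x² = n_x + 2 n_{x↑} n_{x↓}`. -/
theorem numberOp_mul_self' {Λ : Type*} [LinearOrder Λ] [Fintype Λ] (x : Λ) (σ : Fin 2) :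
    numberOp x σ * numberOp x σ = numberOp x σ := by
  rw [LiebThm1.numberOp_eq_diagonal, Matrix.diagonal_mul_diagonal]
  congr 1
  funext s
  split_ifs <;> simp

/-- `n_{x↓} n_{x↑} = n_{x↑} n_{x↓}` (diagonal matrices commute). -/
theorem numberOp_mul_comm' {Λ : Type*} [LinearOrder Λ] [Fintype Λ] (x : Λ) :
    numberOp x 1 * numberOp x 0 = numberOp x 0 * numberOp x 1 := by
  rw [LiebThm1.numberOp_eq_diagonal, LiebThm1.numberOp_eq_diagonal, Matrix.diagonal_mul_diagonal,
    Matrix.diagonal_mul_diagonal]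
  congr 1
  funext s
  split_ifs <;> simp

/-- `n_x² = n_x + 2 n_{x↑} n_{x↓}` for the total site number operator. -/
theorem NAt_mul_self {Λ : Finset (Site 2)} (x : Site 2) (hx : x ∈ Λ) :
    NAt x hx * NAt x hx = NAt x hx + (2 : ℂ) • (nAt x hx 0 * nAt x hx 1) := by
  simp only [NAt, nAt]
  rw [add_mul, mul_add, mul_add, numberOp_mul_self', numberOp_mul_self', numberOp_mul_comm', two_smul]
  abel

/-- `nnCorr ω 0 = ρ + 2·docc ω` for translation-invariant `ω` (from `NAt_mul_self`). -/
theorem nnCorr_zero (hω : ω.IsTranslationInvariant) : nnCorr ω 0 = ω.density + 2 * docc ω := by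
  have hsub : ({0} : Finset (Site 2)) ⊆ {0, 0} := Finset.singleton_subset_iff.2 (Finset.mem_insert_self 0 {0})
  have h := ω.compatible hsub (NAt 0 (Finset.mem_singleton_self 0))
  rw [show fermionEmbed (PolySite.incl hsub) (NAt 0 (Finset.mem_singleton_self 0)) =
      NAt 0 (Finset.mem_insert_self 0 {0}) from by
    simp only [NAt, nAt, map_add, fermionEmbed_numberOp, PolySite.incl_pt]] at h
  rw [nnCorr, NAt_mul_self, map_add, map_smul, Complex.add_re, smul_eq_mul,
    show (2 : ℂ) = ((2 : ℝ) : ℂ) by norm_num, Complex.re_ofReal_mul, re_expect_nAt_mul_nAt_eq_docc hω, h]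
  rfl

/-- The centred site density `D = n_0 − 7/8 ∈ 𝔄_{{0}}`. -/
def Dc : FermionOp ({0} : Finset (Site 2)) :=
  NAt 0 (Finset.mem_singleton_self 0) - ((7/8 : ℝ) : ℂ) • (1 : FermionOp ({0} : Finset (Site 2)))

/-- `Dc` is self-adjoint. -/
theorem Dc_conjTranspose : Dcᴴ = Dc := by
  have h0 : (nAt 0 (Finset.mem_singleton_self 0) 0 : FermionOp ({0} : Finset (Site 2)))ᴴ =
      nAt 0 (Finset.mem_singleton_self 0) 0 := (numberAt_isHermitian _).eq
  have h1 : (nAt 0 (Finset.mem_singleton_self 0) 1 : FermionOp ({0} : Finset (Site 2)))ᴴ =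
      nAt 0 (Finset.mem_singleton_self 0) 1 := (numberAt_isHermitian _).eq
  rw [Dc, NAt, Matrix.conjTranspose_sub, Matrix.conjTranspose_add, h0, h1, Matrix.conjTranspose_smul,
    Matrix.conjTranspose_one, Complex.star_def, Complex.conj_ofReal]

/-- The two-site correlation `ω.corr n_0 (τ_v n_0)` as an expectation over `{0, v}`. -/
theorem corr_N0_shiftEmb_eq (v : Site 2) :
    ω.corr (NAt 0 (Finset.mem_singleton_self 0))
        (fermionEmbed (PolySite.shiftEmb v {0}) (NAt 0 (Finset.mem_singleton_self 0))) =
      ω.expect {0, v} (NAt 0 (Finset.mem_insert_self 0 {v}) *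
        NAt v (Finset.mem_insert_of_mem (Finset.mem_singleton_self v))) := by
  have h₁ : ({0} : Finset (Site 2)) ⊆ {0, v} := Finset.singleton_subset_iff.2 (Finset.mem_insert_self 0 {v})
  have h₂ : shiftSet v ({0} : Finset (Site 2)) ⊆ {0, v} :=
    (shiftSet_singleton_zero_subset' v).trans
      (Finset.singleton_subset_iff.2 (Finset.mem_insert_of_mem (Finset.mem_singleton_self v)))
  rw [ω.corr_eq_expect_of_subset h₁ h₂]
  congr 1
  simp only [NAt, nAt, map_add, fermionEmbed_numberOp, PolySite.incl_pt, PolySite.shiftEmb_pt]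
  rw [pt_congr' (zero_add v) _ (Finset.mem_insert_of_mem (Finset.mem_singleton_self v))]

/-- Dictionary: `Re ω(Dc · τ_v Dc) = nnCorr ω v − 49/64` for translation-invariant `ω` of density `7/8`. -/
theorem re_corr_Dc (hω : ω.IsTranslationInvariant) (hn : ω.density = 7/8) (v : Site 2) :
    (ω.corr Dc (fermionEmbed (PolySite.shiftEmb v {0}) Dc)).re = nnCorr ω v - 49/64 := by
  have hop : ∀ (U : Finset (Site 2)) (A B : FermionOp U) (c : ℂ),
      (A - c • 1) * (B - c • 1) = A * B - c • A - c • B + (c * c) • 1 := by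
    intro U A B c
    simp only [sub_mul, mul_sub, smul_mul_assoc, mul_smul_comm, one_mul, mul_one, smul_smul, smul_sub]
    abel
  have hv : ω.expect (shiftSet v {0}) (fermionEmbed (PolySite.shiftEmb v {0}) (NAt 0 (Finset.mem_singleton_self 0))) =
      ω.expect {0} (NAt 0 (Finset.mem_singleton_self 0)) := by
    rw [← InfVolFermionState.shift_expect, hω v]
  have hρ : (ω.expect {0} (NAt 0 (Finset.mem_singleton_self 0))).re = 7/8 := hn
  rw [InfVolFermionState.corr_eq]
  simp only [Dc, map_sub, map_smul, map_one]
  rw [hop, map_add, map_sub, map_sub, map_smul, map_smul, map_smul, ω.expect_one, ω.compatible, ω.compatible, hv,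
    ← InfVolFermionState.corr_eq, corr_N0_shiftEmb_eq]
  simp only [nnCorr, Complex.add_re, Complex.sub_re, smul_eq_mul, Complex.re_ofReal_mul, ← Complex.ofReal_mul,
    Complex.ofReal_re, hρ, mul_one]
  ring

/-- The `D₄`-averaged centred density correlation `C(r) = 8⁻¹ Σ_γ ω(D · τ_{γr} D)`. -/
def chargeOrbitCorr (ω : InfVolFermionState 2) (r : Site 2) : ℂ :=
  (((8 : ℝ)⁻¹ : ℝ) : ℂ) * ∑ g : DihedralGroup 4, ω.corr Dc (fermionEmbed (PolySite.shiftEmb (d4Vec g r) {0}) Dc)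

/-- `chargeOrbitCorr ω` is positive definite for translation-invariant `ω` (S2a + the `D₄` orbit mean). -/
theorem isPositiveDefinite_chargeOrbitCorr (hω : ω.IsTranslationInvariant) :
    Literature.Analysis.FunctionSpaces.IsPositiveDefinite (chargeOrbitCorr ω) := by
  have h1 : ∀ g : DihedralGroup 4, Literature.Analysis.FunctionSpaces.IsPositiveDefinite
      (fun r : Site 2 => ω.corr Dc (fermionEmbed (PolySite.shiftEmb (d4Vec g r) {0}) Dc)) := by
    intro g
    have h := isPositiveDefinite_comp_d4Vec (hω.isPositiveDefinite_corr Dc) g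
    rw [Dc_conjTranspose] at h
    exact h
  have h2 := Literature.Analysis.FunctionSpaces.IsPositiveDefinite.sum Finset.univ (fun g _ => h1 g)
  have h3 := h2.real_smul (r := (8 : ℝ)⁻¹) (by norm_num)
  exact h3

/-- `Re chargeOrbitCorr ω r = 8⁻¹ Σ_γ (nnCorr ω (γr) − 49/64)`. -/
private theorem chargeOrbitCorr_re_eq (hω : ω.IsTranslationInvariant) (hn : ω.density = 7/8) (r : Site 2) :
    (chargeOrbitCorr ω r).re = (8 : ℝ)⁻¹ * ∑ g : DihedralGroup 4, (nnCorr ω (d4Vec g r) - 49/64) := by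
  rw [chargeOrbitCorr, Complex.re_ofReal_mul, Complex.re_sum]
  congr 1
  exact Finset.sum_congr rfl fun g _ => re_corr_Dc hω hn _

/-- `Re chargeOrbitCorr ω 0 = 7/64 + 2·docc ω`. -/
theorem chargeOrbitCorr_re_zero (hω : ω.IsTranslationInvariant) (hn : ω.density = 7/8) :
    (chargeOrbitCorr ω ![0, 0]).re = 7/64 + 2 * docc ω := by
  have h0 : (![0, 0] : Site 2) = 0 := by decide
  rw [chargeOrbitCorr_re_eq hω hn, d4_sum_zero (fun w => nnCorr ω w - 49/64), h0, nnCorr_zero hω, hn]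
  ring

/-- `Re chargeOrbitCorr ω e₁ = densnn ω − 49/64`. -/
theorem chargeOrbitCorr_re_e1 (hω : ω.IsTranslationInvariant) (hn : ω.density = 7/8) :
    (chargeOrbitCorr ω ![1, 0]).re = densnn ω - 49/64 := by
  rw [chargeOrbitCorr_re_eq hω hn, d4_sum_e1 (fun w => nnCorr ω w - 49/64), densnn]; ring
/-- `Re chargeOrbitCorr ω (−e₁) = densnn ω − 49/64`. -/
theorem chargeOrbitCorr_re_me1 (hω : ω.IsTranslationInvariant) (hn : ω.density = 7/8) :
    (chargeOrbitCorr ω ![-1, 0]).re = densnn ω - 49/64 := by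
  rw [chargeOrbitCorr_re_eq hω hn, d4_sum_me1 (fun w => nnCorr ω w - 49/64), densnn]; ring
/-- `Re chargeOrbitCorr ω e₂ = densnn ω − 49/64`. -/
theorem chargeOrbitCorr_re_e2 (hω : ω.IsTranslationInvariant) (hn : ω.density = 7/8) :
    (chargeOrbitCorr ω ![0, 1]).re = densnn ω - 49/64 := by
  rw [chargeOrbitCorr_re_eq hω hn, d4_sum_e2 (fun w => nnCorr ω w - 49/64), densnn]; ring
/-- `Re chargeOrbitCorr ω (−e₂) = densnn ω − 49/64`. -/
theorem chargeOrbitCorr_re_me2 (hω : ω.IsTranslationInvariant) (hn : ω.density = 7/8) :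
    (chargeOrbitCorr ω ![0, -1]).re = densnn ω - 49/64 := by
  rw [chargeOrbitCorr_re_eq hω hn, d4_sum_me2 (fun w => nnCorr ω w - 49/64), densnn]; ring

/-- `Re ω(Γ(γ) G_c) = (17/18) docc + (1/6)(Re ω(n_0 n_{γe₁}) + Re ω(n_0 n_{γe₂}))`. -/
theorem re_expect_d4_chargeGc (hω : ω.IsTranslationInvariant) (g : DihedralGroup 4) :
    (ω.expect (d4ShiftSet g 0 nnSupport) (fermionEmbed (PolySite.d4Emb g 0 nnSupport) chargeGc)).re =
      17/18 * docc ω + 1/6 * (nnCorr ω (d4Vec g (unitVec 0)) + nnCorr ω (d4Vec g (unitVec 1))) := by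
  rw [chargeGc_eq, map_add, map_smul, map_smul, map_add]
  simp only [NAt, nAt, map_mul, map_add, fermionEmbed_numberOp, d4Emb_pt]
  simp only [map_smul, map_add, Complex.add_re, smul_eq_mul]
  push_cast
  rw [show (17/18 : ℂ) = ((17/18 : ℝ) : ℂ) by norm_num, show (1/6 : ℂ) = ((1/6 : ℝ) : ℂ) by norm_num,
    Complex.re_ofReal_mul, Complex.re_ofReal_mul, Complex.add_re,
    re_expect_nAt_mul_nAt_eq_docc hω,
    re_expect_NAt_mul_NAt_eq_corr hω (d4Vec g 0 + 0) (d4Vec g (unitVec 0) + 0),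
    re_expect_NAt_mul_NAt_eq_corr hω (d4Vec g 0 + 0) (d4Vec g (unitVec 1) + 0)]
  simp only [d4Vec_zero, add_zero, sub_zero]

/-- The row's `D₄`-averaged charge functional bound `≤ q` gives `(17/18) docc + (1/3) densnn ≤ q` (dictionary for the `hrow` hypothesis of the charge-star ceilings). -/
theorem charge_hrow_of (hω : ω.IsTranslationInvariant) {q : ℝ}
    (h : ((Finset.univ : Finset (DihedralGroup 4)).card : ℝ)⁻¹ *
        ∑ g ∈ (Finset.univ : Finset (DihedralGroup 4)),
          (ω.expect (d4ShiftSet g 0 nnSupport) (fermionEmbed (PolySite.d4Emb g 0 nnSupport) chargeGc)).re ≤ q) :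
    17/18 * docc ω + 1/3 * densnn ω ≤ q := by
  simp only [re_expect_d4_chargeGc hω, unitVec_zero_eq, unitVec_one_eq, Finset.sum_add_distrib, Finset.sum_const,
    Finset.card_univ, DihedralGroup.card, nsmul_eq_mul, ← Finset.mul_sum, d4_sum_e1 (nnCorr ω),
    d4_sum_e2 (nnCorr ω)] at h
  unfold densnn
  push_cast at h
  linarith

end ChargeDictionary

end Summit.Ventures.CertifiedManyBodySolver.Certificates

end
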